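import Literature.RepresentationTheory.Kovacevic2021.SU21RelativeCochainsDegreeOne
import HarnessLib

/-!
# Kovačević's `SU(2,1)`-modules: the relative `(𝔤, 𝔨)`-cochains in degree `2`,
# `C²(𝔤, 𝔨; V) = Hom_𝔨(Λ² 𝔭, V)`, on the tree's Chevalley–Eilenberg carriers

Topic `RepresentationTheory/Kovacevic2021`; namespace `Literature.RepresentationTheory.Kovacevic2021`.
Definitions with bodies and theorems only; no named fact.  Sequel to `SU21RelativeCochainsDegreeOne`
(`𝔤 = 𝔤𝔩(3,ℂ) ⊃ 𝔨 = kSub`, `𝔭 = ⟨E₀₂, E₁₂⟩ ⊕ ⟨E₂₀, E₂₁⟩`, `relCochain 𝒟 q = C^q(𝔤, 𝔨; V)` for the module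
`V = 𝒟.V` of a `K`-type datum `𝒟` [Kovacevic2021, §3]).

As a `𝔨`-module `Λ²𝔭 = Λ²𝔭⁺ ⊕ (𝔭⁺ ⊗ 𝔭⁻) ⊕ Λ²𝔭⁻ = F_{2,0} ⊕ (F_{1,1} ⊕ F_{0,0}) ⊕ F_{0,2}`
[BorelWallach2000, VI 4.8 (5), Lemma 4.9 (1): `Λ^{1,1} = LΛ^{0,0} ⊕ F_{1,1}`], i.e. the `K`-types
`V_{1,6} ⊕ V_{3,0} ⊕ V_{1,0} ⊕ V_{1,-6}` with highest-weight vectors `E₀₂∧E₁₂`, `E₀₂∧E₂₁`,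
`E₁₂∧E₂₁ - E₀₂∧E₂₀` (the `𝔨`-invariant class `L`) and `E₂₀∧E₂₁`.  Accordingly:

* `mem_relCochain_two_iff`: a `2`-cochain is relative iff `⁅x, f(y,z)⁆ = f(⁅x,y⁆, z) + f(y, ⁅x,z⁆)` and
  `f(x, z) = 0` for `x ∈ 𝔨` (`lieDer_two_apply`: the degree-`2` Lie derivative of the tree's recursion);
* the four values `f(E₀₂,E₁₂)`, `f(E₀₂,E₂₁)`, `-f(E₀₂,E₂₀) - f(E₁₂,E₂₁)`, `f(E₂₀,E₂₁)` of a relative `2`-cochain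
  are `𝔨`-highest-weight vectors of types `(1,6)`, `(3,0)`, `(1,0)`, `(1,-6)` (`apply_*_mem_hwSpace₂`), and
  determine it (`eq_twoCochain`): `f(y,z) = ∑_{a<b} (y_a z_b - y_b z_a) f(E_a, E_b)` over the four
  `𝔭`-coordinates, with `f(E₁₂,E₂₁) = ½(Y_α w₂ - w₃)`, `f(E₀₂,E₂₀) = -½(Y_α w₂ + w₃)`,
  `f(E₁₂,E₂₀) = -½ Y_α(Y_α w₂ - w₃)`;
* the builder `twoCochain w₁ w₂ w₃ w₄` (the uncurried alternating pairing `pairForm` with these pair values;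
  `twoCochain_apply`), in terms of which `eq_twoCochain` reads `f = twoCochain (f(E₀₂,E₁₂)) (f(E₀₂,E₂₁)) (…) (…)`.

NOT here (sequel `SU21RelativeCochainsDegreeTwoEquiv`): that `twoCochain` of highest-weight vectors IS relative
(`twoCochain_mem`), the equivalence `C²(𝔤, 𝔨; V) ≃ₗ hw(1,6) × hw(3,0) × hw(1,0) × hw(1,-6)` and the dimension
formula `dim C² = [(1,6) ∈ S] + [(3,0) ∈ S] + [(1,0) ∈ S] + [(1,-6) ∈ S]`; the differential in degree `2`;
degrees `≥ 3`.

## References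

* A. Borel, N. Wallach (2000), I §1.2 (1); VI 4.8 (4)–(5), Lemma 4.9 (1), pp. 130–131 (held chunks p0059,
  p0165–p0167). [BorelWallach2000]
* C. Chevalley, S. Eilenberg, Trans. AMS 63 (1948), §23 (23.3), (23.5), §28. [ChevalleyEilenberg1948]
* D. Kovačević, Acta Math. Spalatensia 1 (2021) 105–125, §3 Def 1, Thm 1. [Kovacevic2021]
-/

noncomputable section

open Finsupp Module
open Literature.Algebra.Lie Literature.Algebra.Lie.ChevalleyEilenberg

namespace Literature.RepresentationTheory.Kovacevic2021

-- Mathlib idiom (Mathlib/Algebra/Lie/OfAssociative.lean): bracket on `Matrix`/`Module.End` = commutator.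
attribute [local instance 100] LieRing.ofAssociativeRing

/-! ### The Lie derivative in degree `2` (any Lie algebra and module) -/

section Generic

variable {R : Type*} [CommRing R] {L : Type*} [LieRing L] [LieAlgebra R L]
  {M : Type*} [AddCommGroup M] [Module R M] [LieRingModule L M] [LieModule R L M]

/-- `(θ_x f)(y, z) = ⁅x, f(y,z)⁆ - f(⁅x,y⁆, z) - f(y, ⁅x,z⁆)` in degree `2` (from the tree's recursion
`i_y θ_x = θ_x i_y - i_{⁅x,y⁆}` and the degree-`1` formula). [cite: ChevalleyEilenberg1948, §23 (23.3), (23.5)] -/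
theorem lieDer_two_apply (x y z : L) (f : Cochain R L M 2) :
    lieDer R L M 2 x f ![y, z] = ⁅x, f ![y, z]⁆ - f ![⁅x, y⁆, z] - f ![y, ⁅x, z⁆] := by
  have e := congrArg (fun φ : Cochain R L M 1 => φ ![z]) (ins_lieDer (R := R) (M := M) 1 x y f)
  simp only [AlternatingMap.sub_apply, ins_apply, lieDer_one_apply] at e
  have h1 : (Matrix.vecCons y ![z] : Fin 2 → L) = ![y, z] := rfl
  have h2 : (Matrix.vecCons y ![⁅x, z⁆] : Fin 2 → L) = ![y, ⁅x, z⁆] := rfl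
  have h3 : (Matrix.vecCons ⁅x, y⁆ ![z] : Fin 2 → L) = ![⁅x, y⁆, z] := rfl
  rw [h1, h2, h3] at e
  rw [e]
  abel

end Generic

namespace SU21Datum

variable (𝒟 : SU21Datum)

/-! ### Slot calculus for `2`-cochains -/

section Slots

variable {𝒟}

/-- a `2`-cochain only sees `(v 0, v 1)` [folklore] -/
private theorem two_apply_eq (f : Cochain ℂ gl3 𝒟.V 2) (v : Fin 2 → gl3) : f v = f ![v 0, v 1] := by
  congr 1
  ext i
  fin_cases i <;> rfl

/-- additivity in the first slot [folklore] -/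
private theorem two_add_left (f : Cochain ℂ gl3 𝒟.V 2) (y y' z : gl3) : f ![y + y', z] = f ![y, z] + f ![y', z] := by
  have h := f.map_update_add (v := ![(0 : gl3), z]) 0 y y'
  have e : ∀ w : gl3, Function.update ![(0 : gl3), z] 0 w = ![w, z] := fun w => by
    ext i; fin_cases i <;> simp
  simpa only [e] using h

/-- homogeneity in the first slot [folklore] -/
private theorem two_smul_left (f : Cochain ℂ gl3 𝒟.V 2) (c : ℂ) (y z : gl3) : f ![c • y, z] = c • f ![y, z] := by
  have h := f.map_update_smul (v := ![(0 : gl3), z]) 0 c y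
  have e : ∀ w : gl3, Function.update ![(0 : gl3), z] 0 w = ![w, z] := fun w => by
    ext i; fin_cases i <;> simp
  simpa only [e] using h

/-- additivity in the second slot [folklore] -/
private theorem two_add_right (f : Cochain ℂ gl3 𝒟.V 2) (y z z' : gl3) : f ![y, z + z'] = f ![y, z] + f ![y, z'] := by
  have h := f.map_update_add (v := ![y, (0 : gl3)]) 1 z z'
  have e : ∀ w : gl3, Function.update ![y, (0 : gl3)] 1 w = ![y, w] := fun w => by
    ext i; fin_cases i <;> simp
  simpa only [e] using h

/-- homogeneity in the second slot [folklore] -/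
private theorem two_smul_right (f : Cochain ℂ gl3 𝒟.V 2) (c : ℂ) (y z : gl3) : f ![y, c • z] = c • f ![y, z] := by
  have h := f.map_update_smul (v := ![y, (0 : gl3)]) 1 c z
  have e : ∀ w : gl3, Function.update ![y, (0 : gl3)] 1 w = ![y, w] := fun w => by
    ext i; fin_cases i <;> simp
  simpa only [e] using h

/-- antisymmetry [folklore] -/
private theorem two_swap (f : Cochain ℂ gl3 𝒟.V 2) (y z : gl3) : f ![z, y] = -f ![y, z] := by
  have h := f.map_swap ![y, z] (i := 0) (j := 1) (by decide)
  have e : (![y, z] : Fin 2 → gl3) ∘ Equiv.swap 0 1 = ![z, y] := by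
    ext i; fin_cases i <;> rfl
  rw [e] at h
  exact h

/-- alternation [folklore] -/
private theorem two_self (f : Cochain ℂ gl3 𝒟.V 2) (y : gl3) : f ![y, y] = 0 :=
  f.map_eq_zero_of_eq ![y, y] (i := 0) (j := 1) rfl (by decide)

/-- `f(-y, z) = -f(y, z)` [folklore] -/
private theorem two_neg_left (f : Cochain ℂ gl3 𝒟.V 2) (y z : gl3) : f ![-y, z] = -f ![y, z] := by
  rw [← neg_one_smul ℂ y, two_smul_left, neg_one_smul]

/-- `f(y, -z) = -f(y, z)` [folklore] -/
private theorem two_neg_right (f : Cochain ℂ gl3 𝒟.V 2) (y z : gl3) : f ![y, -z] = -f ![y, z] := by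
  rw [← neg_one_smul ℂ z, two_smul_right, neg_one_smul]

/-- `f(0, z) = 0` [folklore] -/
private theorem two_zero_left (f : Cochain ℂ gl3 𝒟.V 2) (z : gl3) : f ![(0 : gl3), z] = 0 := by
  rw [← zero_smul ℂ (0 : gl3), two_smul_left, zero_smul]

/-- `f(y, 0) = 0` [folklore] -/
private theorem two_zero_right (f : Cochain ℂ gl3 𝒟.V 2) (y : gl3) : f ![y, (0 : gl3)] = 0 := by
  rw [← zero_smul ℂ (0 : gl3), two_smul_right, zero_smul]

end Slots

/-! ### `C²(𝔤, 𝔨; V)`: relative `2`-cochains -/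

variable {𝒟} in
/-- **`C²(𝔤, 𝔨; V)`**: a `2`-cochain is relative iff it is `𝔨`-equivariant
(`⁅x, f(y,z)⁆ = f(⁅x,y⁆, z) + f(y, ⁅x,z⁆)` for `x ∈ 𝔨`) and horizontal (`f(x, z) = 0` for `x ∈ 𝔨`).
[cite: BorelWallach2000, I §1.2 (1)] [cite: ChevalleyEilenberg1948, §28 (28.1)–(28.2)] -/
theorem mem_relCochain_two_iff (f : Cochain ℂ gl3 𝒟.V 2) :
    f ∈ 𝒟.relCochain 2 ↔
      (∀ x ∈ kSub, ∀ y z : gl3, ⁅x, f ![y, z]⁆ = f ![⁅x, y⁆, z] + f ![y, ⁅x, z⁆]) ∧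
        ∀ x ∈ kSub, ∀ z : gl3, f ![x, z] = 0 := by
  rw [relCochain, Subcomplex.mem_rel_succ_iff]
  constructor
  · intro h
    refine ⟨fun x hx y z => ?_, fun x hx z => ?_⟩
    · have e : lieDer ℂ gl3 𝒟.V 2 x f ![y, z] = (0 : Cochain ℂ gl3 𝒟.V 2) ![y, z] := by rw [(h x hx).1]
      rw [lieDer_two_apply, AlternatingMap.zero_apply, sub_sub, sub_eq_zero] at e
      exact e
    · have e : ins 1 x f ![z] = (0 : Cochain ℂ gl3 𝒟.V 1) ![z] := by rw [(h x hx).2]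
      rwa [ins_apply, AlternatingMap.zero_apply] at e
  · rintro ⟨h1, h2⟩ x hx
    refine ⟨?_, ?_⟩
    · refine AlternatingMap.ext fun v => ?_
      rw [two_apply_eq _ v, lieDer_two_apply, AlternatingMap.zero_apply, h1 x hx]
      abel
    · refine AlternatingMap.ext fun v => ?_
      rw [ins_apply, AlternatingMap.zero_apply, show v = ![v 0] from by ext i; fin_cases i; rfl]
      exact h2 x hx (v 0)

/-! #### More matrix identities -/

/-- `⁅E₀₁, E₁₂⁆ = E₀₂`, `⁅E₀₀ - E₁₁, E₁₂⁆ = -E₁₂`, `⁅Z, E₁₂⁆ = 3E₁₂`, `⁅E₁₀, E₁₂⁆ = 0` (`E₁₂ = Y_α E₀₂` is the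
second basis vector of `𝔭⁺ ≅ V_{2,3}`). [cite: Kovacevic2021, §3 Def 1] -/
theorem lie_E12 : ⁅E 0 1, E 1 2⁆ = E 0 2 ∧ ⁅E 0 0 - E 1 1, E 1 2⁆ = -E 1 2 ∧
    ⁅E 0 0 + E 1 1 - (2 : ℂ) • E 2 2, E 1 2⁆ = (3 : ℂ) • E 1 2 ∧ ⁅E 1 0, E 1 2⁆ = 0 := by
  refine ⟨?_, ?_, ?_, ?_⟩
  all_goals
    ext a b
    fin_cases a <;> fin_cases b <;>
      simp [LieRing.of_associative_ring_bracket, Matrix.mul_apply, Matrix.single_apply]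
  all_goals norm_num

/-- `⁅E₀₁, E₂₀⁆ = -E₂₁`, `⁅E₀₀ - E₁₁, E₂₀⁆ = -E₂₀`, `⁅Z, E₂₀⁆ = -3E₂₀`, `⁅E₁₀, E₂₀⁆ = 0` (`E₂₀ = -Y_α E₂₁` in
`𝔭⁻ ≅ V_{2,-3}`). [cite: Kovacevic2021, §3 Def 1] -/
theorem lie_E20 : ⁅E 0 1, E 2 0⁆ = -E 2 1 ∧ ⁅E 0 0 - E 1 1, E 2 0⁆ = -E 2 0 ∧
    ⁅E 0 0 + E 1 1 - (2 : ℂ) • E 2 2, E 2 0⁆ = (-3 : ℂ) • E 2 0 ∧ ⁅E 1 0, E 2 0⁆ = 0 := by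
  refine ⟨?_, ?_, ?_, ?_⟩
  all_goals
    ext a b
    fin_cases a <;> fin_cases b <;>
      simp [LieRing.of_associative_ring_bracket, Matrix.mul_apply, Matrix.single_apply]
  all_goals norm_num

/-! #### The four highest-weight values of a relative `2`-cochain -/

section Values

variable {𝒟} {f : Cochain ℂ gl3 𝒟.V 2}

/-- `Z = E₀₀ + E₁₁ - 2E₂₂ ∈ 𝔨` [folklore] -/
private theorem hZmem : E 0 0 + E 1 1 - (2 : ℂ) • E 2 2 ∈ kSub :=
  kSub.sub_mem (kSub.add_mem (E_mem_kSub 0 0 (by decide)) (E_mem_kSub 1 1 (by decide)))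
    (kSub.smul_mem _ (E_mem_kSub 2 2 (by decide)))

/-- `H_α = E₀₀ - E₁₁ ∈ 𝔨` [folklore] -/
private theorem hHmem : E 0 0 - E 1 1 ∈ kSub := kSub.sub_mem (E_mem_kSub 0 0 (by decide)) (E_mem_kSub 1 1 (by decide))

/-- `f(E₀₂, E₁₂)` is a `𝔨`-highest-weight vector of type `(1,6)` (`Λ²𝔭⁺ = F_{2,0} = V_{1,6}`).
[cite: BorelWallach2000, VI 4.8 (5)] -/
theorem apply_E02_E12_mem_hwSpace (hf : f ∈ 𝒟.relCochain 2) : f ![E 0 2, E 1 2] ∈ 𝒟.hwSpace 1 6 := by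
  obtain ⟨h1, -⟩ := (mem_relCochain_two_iff f).1 hf
  obtain ⟨a1, a2, a3⟩ := lie_E02
  obtain ⟨b1, b2, b3, -⟩ := lie_E12
  rw [mem_hwSpace_iff_lie, h1 _ (E_mem_kSub 0 1 (by decide)), a1, b1, h1 _ hHmem, a2, b2, h1 _ hZmem, a3, b3]
  simp only [two_zero_left, two_self, two_neg_right, two_smul_left, two_smul_right]
  push_cast
  refine ⟨by module, by module, by module⟩

/-- `f(E₂₀, E₂₁)` is a `𝔨`-highest-weight vector of type `(1,-6)` (`Λ²𝔭⁻ = F_{0,2} = V_{1,-6}`).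
[cite: BorelWallach2000, VI 4.8 (5)] -/
theorem apply_E20_E21_mem_hwSpace (hf : f ∈ 𝒟.relCochain 2) : f ![E 2 0, E 2 1] ∈ 𝒟.hwSpace 1 (-6) := by
  obtain ⟨h1, -⟩ := (mem_relCochain_two_iff f).1 hf
  obtain ⟨a1, a2, a3⟩ := lie_E21
  obtain ⟨b1, b2, b3, -⟩ := lie_E20
  rw [mem_hwSpace_iff_lie, h1 _ (E_mem_kSub 0 1 (by decide)), b1, a1, h1 _ hHmem, b2, a2, h1 _ hZmem, b3, a3]
  simp only [two_zero_right, two_self, two_neg_left, two_smul_left, two_smul_right]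
  push_cast
  refine ⟨by module, by module, by module⟩

/-- `f(E₀₂, E₂₁)` is a `𝔨`-highest-weight vector of type `(3,0)` (`F_{1,1} = V_{3,0} ⊂ 𝔭⁺ ⊗ 𝔭⁻`).
[cite: BorelWallach2000, VI Lemma 4.9 (1)] -/
theorem apply_E02_E21_mem_hwSpace (hf : f ∈ 𝒟.relCochain 2) : f ![E 0 2, E 2 1] ∈ 𝒟.hwSpace 3 0 := by
  obtain ⟨h1, -⟩ := (mem_relCochain_two_iff f).1 hf
  obtain ⟨a1, a2, a3⟩ := lie_E02
  obtain ⟨b1, b2, b3⟩ := lie_E21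
  rw [mem_hwSpace_iff_lie, h1 _ (E_mem_kSub 0 1 (by decide)), a1, b1, h1 _ hHmem, a2, b2, h1 _ hZmem, a3, b3]
  simp only [two_zero_left, two_zero_right, two_smul_left, two_smul_right]
  push_cast
  refine ⟨by module, by module, by module⟩

/-- `-f(E₀₂, E₂₀) - f(E₁₂, E₂₁)` is `𝔨`-invariant (type `(1,0)`: the class `L` of `F_{0,0} ⊂ Λ^{1,1}`).
[cite: BorelWallach2000, VI 4.8 (4), Lemma 4.9 (1)] -/
theorem apply_L_mem_hwSpace (hf : f ∈ 𝒟.relCochain 2) :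
    -f ![E 0 2, E 2 0] - f ![E 1 2, E 2 1] ∈ 𝒟.hwSpace 1 0 := by
  obtain ⟨h1, -⟩ := (mem_relCochain_two_iff f).1 hf
  obtain ⟨a1, a2, a3⟩ := lie_E02
  obtain ⟨b1, b2, b3⟩ := lie_E21
  obtain ⟨c1, c2, c3, -⟩ := lie_E12
  obtain ⟨d1, d2, d3, -⟩ := lie_E20
  rw [mem_hwSpace_iff_lie, lie_sub, lie_neg, lie_sub, lie_neg, lie_sub, lie_neg,
    h1 _ (E_mem_kSub 0 1 (by decide)), h1 _ (E_mem_kSub 0 1 (by decide)), a1, d1, c1, b1, h1 _ hHmem, h1 _ hHmem,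
    a2, d2, c2, b2, h1 _ hZmem, h1 _ hZmem, a3, d3, c3, b3]
  simp only [two_zero_left, two_zero_right, two_neg_left, two_neg_right, two_smul_left, two_smul_right]
  push_cast
  refine ⟨by module, by module, by module⟩

/-- the `Y_α`-descent relations among the pair values: `f(E₁₂,E₂₁) - f(E₀₂,E₂₀) = Y_α f(E₀₂,E₂₁)` and
`f(E₁₂,E₂₀) = -Y_α f(E₁₂,E₂₁)` (from `θ_{E₁₀} f = 0`). [cite: Kovacevic2021, §3 Def 1] -/
theorem apply_descent (hf : f ∈ 𝒟.relCochain 2) :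
    f ![E 1 2, E 2 1] - f ![E 0 2, E 2 0] = 𝒟.Ya (f ![E 0 2, E 2 1]) ∧
      f ![E 1 2, E 2 0] = -𝒟.Ya (f ![E 1 2, E 2 1]) := by
  obtain ⟨h1, -⟩ := (mem_relCochain_two_iff f).1 hf
  obtain ⟨e1, e2⟩ := lie_E10
  obtain ⟨-, -, -, c4⟩ := lie_E12
  have hY : ∀ v : 𝒟.V, 𝒟.Ya v = ⁅E 1 0, v⁆ := fun v => by rw [lie_def, ρfun_E]
  refine ⟨?_, ?_⟩
  · rw [hY, h1 _ (E_mem_kSub 1 0 (by decide)), e1, e2, two_neg_right]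
    abel
  · rw [hY, h1 _ (E_mem_kSub 1 0 (by decide)), c4, e2, two_zero_left, two_neg_right]
    abel

end Values


/-! #### Expansion of a relative `2`-cochain over the `𝔭`-coordinates -/

section Expand

variable {𝒟} {f : Cochain ℂ gl3 𝒟.V 2}

/-- first-slot expansion `f(y, z) = ∑_a y_a f(E_a, z)` (horizontality kills the `𝔨`-part of `y`)
[cite: BorelWallach2000, I §1.2 (1)] -/
theorem two_expand_left (hf : f ∈ 𝒟.relCochain 2) (y z : gl3) :
    f ![y, z] = y 0 2 • f ![E 0 2, z] + y 1 2 • f ![E 1 2, z] + y 2 0 • f ![E 2 0, z] + y 2 1 • f ![E 2 1, z] := by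
  obtain ⟨-, h2⟩ := (mem_relCochain_two_iff f).1 hf
  conv_lhs => rw [← kPart_add y]
  rw [two_add_left, two_add_left, two_add_left, two_add_left, h2 _ (kPart_mem y), two_smul_left, two_smul_left,
    two_smul_left, two_smul_left, zero_add]

/-- second-slot expansion `f(a, z) = ∑_b z_b f(a, E_b)` [cite: BorelWallach2000, I §1.2 (1)] -/
theorem two_expand_right (hf : f ∈ 𝒟.relCochain 2) (a z : gl3) :
    f ![a, z] = z 0 2 • f ![a, E 0 2] + z 1 2 • f ![a, E 1 2] + z 2 0 • f ![a, E 2 0] + z 2 1 • f ![a, E 2 1] := by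
  obtain ⟨-, h2⟩ := (mem_relCochain_two_iff f).1 hf
  conv_lhs => rw [← kPart_add z]
  rw [two_add_right, two_add_right, two_add_right, two_add_right, two_swap f (kPart z) a, h2 _ (kPart_mem z),
    neg_zero, two_smul_right, two_smul_right, two_smul_right, two_smul_right, zero_add]

/-- **pair expansion**: `f(y, z) = ∑_{a<b} (y_a z_b - y_b z_a) f(E_a, E_b)` over the four `𝔭`-coordinates
`a, b ∈ {02, 12, 20, 21}`. [cite: BorelWallach2000, I §1.2 (1)] -/
theorem two_expand (hf : f ∈ 𝒟.relCochain 2) (y z : gl3) :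
    f ![y, z] =
      (y 0 2 * z 1 2 - y 1 2 * z 0 2) • f ![E 0 2, E 1 2] + (y 0 2 * z 2 0 - y 2 0 * z 0 2) • f ![E 0 2, E 2 0]
        + (y 0 2 * z 2 1 - y 2 1 * z 0 2) • f ![E 0 2, E 2 1] + (y 1 2 * z 2 0 - y 2 0 * z 1 2) • f ![E 1 2, E 2 0]
        + (y 1 2 * z 2 1 - y 2 1 * z 1 2) • f ![E 1 2, E 2 1] + (y 2 0 * z 2 1 - y 2 1 * z 2 0) • f ![E 2 0, E 2 1] := by
  rw [two_expand_left hf y z, two_expand_right hf (E 0 2) z, two_expand_right hf (E 1 2) z,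
    two_expand_right hf (E 2 0) z, two_expand_right hf (E 2 1) z, two_self, two_self, two_self, two_self,
    two_swap f (E 0 2) (E 1 2), two_swap f (E 0 2) (E 2 0), two_swap f (E 0 2) (E 2 1), two_swap f (E 1 2) (E 2 0),
    two_swap f (E 1 2) (E 2 1), two_swap f (E 2 0) (E 2 1)]
  module

end Expand

/-! #### The relative `2`-cochain with prescribed highest-weight values -/

/-- The alternating pairing on `𝔤𝔩₃` (vanishing on `𝔨` in either slot) with pair values
`(02,12) ↦ w₁`, `(02,21) ↦ w₂`, `(02,20) ↦ -½(Y_α w₂ + w₃)`, `(12,21) ↦ ½(Y_α w₂ - w₃)`,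
`(12,20) ↦ -½ Y_α(Y_α w₂ - w₃)`, `(20,21) ↦ w₄` — the `𝔨`-map `Λ²𝔭 → V` attached to highest-weight vectors
`w₁, w₂, w₃, w₄` of types `(1,6), (3,0), (1,0), (1,-6)`. [cite: BorelWallach2000, VI 4.8 (5), Lemma 4.9 (1)] -/
def pairForm (w₁ w₂ w₃ w₄ : 𝒟.V) : gl3 →ₗ[ℂ] gl3 →ₗ[ℂ] 𝒟.V :=
  LinearMap.mk₂ ℂ
    (fun y z =>
      (y 0 2 * z 1 2 - y 1 2 * z 0 2) • w₁ + (y 0 2 * z 2 0 - y 2 0 * z 0 2) • (-(1 / 2 : ℂ) • (𝒟.Ya w₂ + w₃))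
        + (y 0 2 * z 2 1 - y 2 1 * z 0 2) • w₂
        + (y 1 2 * z 2 0 - y 2 0 * z 1 2) • (-(1 / 2 : ℂ) • 𝒟.Ya (𝒟.Ya w₂ - w₃))
        + (y 1 2 * z 2 1 - y 2 1 * z 1 2) • ((1 / 2 : ℂ) • (𝒟.Ya w₂ - w₃))
        + (y 2 0 * z 2 1 - y 2 1 * z 2 0) • w₄)
    (fun y y' z => by simp only [Matrix.add_apply]; module)
    (fun c y z => by simp only [Matrix.smul_apply, smul_eq_mul]; module)
    (fun y z z' => by simp only [Matrix.add_apply]; module)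
    (fun c y z => by simp only [Matrix.smul_apply, smul_eq_mul]; module)

/-- unfolding `pairForm` [cite: BorelWallach2000, VI 4.8 (5)] -/
theorem pairForm_apply (w₁ w₂ w₃ w₄ : 𝒟.V) (y z : gl3) :
    𝒟.pairForm w₁ w₂ w₃ w₄ y z =
      (y 0 2 * z 1 2 - y 1 2 * z 0 2) • w₁ + (y 0 2 * z 2 0 - y 2 0 * z 0 2) • (-(1 / 2 : ℂ) • (𝒟.Ya w₂ + w₃))
        + (y 0 2 * z 2 1 - y 2 1 * z 0 2) • w₂
        + (y 1 2 * z 2 0 - y 2 0 * z 1 2) • (-(1 / 2 : ℂ) • 𝒟.Ya (𝒟.Ya w₂ - w₃))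
        + (y 1 2 * z 2 1 - y 2 1 * z 1 2) • ((1 / 2 : ℂ) • (𝒟.Ya w₂ - w₃))
        + (y 2 0 * z 2 1 - y 2 1 * z 2 0) • w₄ := rfl

/-- `pairForm` is alternating [folklore] -/
private theorem pairForm_self (w₁ w₂ w₃ w₄ : 𝒟.V) (y : gl3) : 𝒟.pairForm w₁ w₂ w₃ w₄ y y = 0 := by
  rw [pairForm_apply]
  have h : ∀ a b : ℂ, a * b - b * a = 0 := fun a b => by ring
  simp only [h, zero_smul, add_zero]

/-- `y ↦ (z ↦ pairForm y z)` as a linear map into `1`-cochains [folklore] -/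
private def pairFormCochain (w₁ w₂ w₃ w₄ : 𝒟.V) : gl3 →ₗ[ℂ] Cochain ℂ gl3 𝒟.V 1 where
  toFun y := AlternatingMap.ofSubsingleton ℂ gl3 𝒟.V (0 : Fin 1) (𝒟.pairForm w₁ w₂ w₃ w₄ y)
  map_add' y y' := by
    refine AlternatingMap.ext fun v => ?_
    show 𝒟.pairForm w₁ w₂ w₃ w₄ (y + y') (v 0) = 𝒟.pairForm w₁ w₂ w₃ w₄ y (v 0) + 𝒟.pairForm w₁ w₂ w₃ w₄ y' (v 0)
    rw [map_add, LinearMap.add_apply]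
  map_smul' c y := by
    refine AlternatingMap.ext fun v => ?_
    show 𝒟.pairForm w₁ w₂ w₃ w₄ (c • y) (v 0) = c • 𝒟.pairForm w₁ w₂ w₃ w₄ y (v 0)
    rw [map_smul, LinearMap.smul_apply]

/-- **The relative `2`-cochain with highest-weight values `(w₁, w₂, w₃, w₄)`** (uncurried `pairForm`).
[cite: BorelWallach2000, I §1.2 (1), VI 4.8 (5)] -/
def twoCochain (w₁ w₂ w₃ w₄ : 𝒟.V) : Cochain ℂ gl3 𝒟.V 2 :=
  uncurry (𝒟.pairFormCochain w₁ w₂ w₃ w₄)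
    (uncurry_cond _ fun y => by
      refine AlternatingMap.ext fun v => ?_
      rw [ins_apply, AlternatingMap.zero_apply]
      exact 𝒟.pairForm_self w₁ w₂ w₃ w₄ y)

/-- `twoCochain w v = pairForm w (v 0) (v 1)` [cite: BorelWallach2000, I §1.2 (1)] -/
@[simp] theorem twoCochain_apply (w₁ w₂ w₃ w₄ : 𝒟.V) (v : Fin 2 → gl3) :
    𝒟.twoCochain w₁ w₂ w₃ w₄ v = 𝒟.pairForm w₁ w₂ w₃ w₄ (v 0) (v 1) := by
  rw [twoCochain, uncurry_apply]
  rfl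

variable {𝒟} in
/-- **A relative `2`-cochain is the `twoCochain` of its four highest-weight values.**
[cite: BorelWallach2000, I §1.2 (1), VI Lemma 4.9 (1)] -/
theorem eq_twoCochain {f : Cochain ℂ gl3 𝒟.V 2} (hf : f ∈ 𝒟.relCochain 2) :
    f = 𝒟.twoCochain (f ![E 0 2, E 1 2]) (f ![E 0 2, E 2 1]) (-f ![E 0 2, E 2 0] - f ![E 1 2, E 2 1])
      (f ![E 2 0, E 2 1]) := by
  obtain ⟨d1, d2⟩ := apply_descent hf
  refine AlternatingMap.ext fun v => ?_
  rw [twoCochain_apply, pairForm_apply, two_apply_eq f v, two_expand hf (v 0) (v 1), ← d1]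
  have e1 : f ![E 1 2, E 2 1] - f ![E 0 2, E 2 0] - (-f ![E 0 2, E 2 0] - f ![E 1 2, E 2 1]) =
      (2 : ℂ) • f ![E 1 2, E 2 1] := by module
  rw [e1, map_smul, show 𝒟.Ya (f ![E 1 2, E 2 1]) = -f ![E 1 2, E 2 0] from by rw [d2, neg_neg]]
  module

end SU21Datum

end Literature.RepresentationTheory.Kovacevic2021
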